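import Literature.NumberTheory.EllipticCurves.NeronOggShafarevichLocal
import Literature.NumberTheory.GaloisRepresentations.HeckeCharacterProofs
import Literature.NumberTheory.EllipticCurves.HeegnerPointsKolyvaginCebotarevProofs
import Literature.NumberTheory.EllipticCurves.HeegnerPointsKolyvaginGoodReductionProofs
import Literature.NumberTheory.EllipticCurves.PotentialGoodReductionInertiaProofs
import Literature.NumberTheory.EllipticCurves.RootNumberProofs
import Literature.NumberTheory.EllipticCurves.LFunctionPrimeCoeff
import Literature.NumberTheory.EllipticCurves.BSDRootNumberLocalTablesProofs
import HarnessLib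

/-!
# Line `admdef` (crux `AnticyclotomicEisensteinDivisibility`, stmt-BirchSwinnertonDyer-20727), rigidity road: the RAMIFICATION hypothesis (RAM)
# of Howard's vanishing lemma, DISCHARGED from the line's `ℚ`-side binder «`E[p]` ramified at every `q ∣ N`» by base change `ℚ → K`

LEAD seat bsd-line-sbc-p1 (gen 28), `--supports stmt-BirchSwinnertonDyer-20727` (helper; OFF the v23 composition path).  The vanishing lemma
`…AdmdefHowardVanishing.eq_zero_of_mem_signedOrdSelmerTorsion_of_isUnit_lam` and the assembly `…AdmdefHowardRigidityRoot` carry the hypothesis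
  (RAM) `∀ w` bad for `E/K`, `w ∤ p`: `∃ 𝔔 ∣ w, ∃ τ ∈ I_𝔔 ≤ Γ_K, ∃ P ∈ E_K[p], τ • P ≠ P`
in the BASE-CHANGED currency, whereas the line's skeleton (binder (ii) of C⁺⁺, `…AdmdefRamifiedNS.allRamified_of_allAdditive`, CHKLL25 Thm. 7.1 (ii))
speaks over `ℚ`: `∀ q ∣ N, ∃ v' ∋ q, ∃ 𝔓 ∣ v', ∃ σ ∈ I_𝔓 ≤ Γ_ℚ, ∃ P ∈ E[p], σ • P ≠ P`.  THIS FILE proves the transfer (Neukirch I §9 (9.4):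
`I_𝔔(K̄ ∕ K) = I_𝔓(ℚ̄ ∕ ℚ) ∩ Γ_K`, and `I_𝔓 ≤ Γ_K` when the prime under `𝔓` is unramified in the Galois extension `K ∕ ℚ`):

* `exists_primesAbove_mem_inertia_iff_of_mem_primesAbove` — for an algebraic extension `L ∕ K` of number fields, a place `w ∣ v` and ANY prime
  `𝔔 ∣ w` of `\bar ℤ_L`, there is a prime `𝔓 ∣ v` of `\bar ℤ_K` (namely `ι⁻¹ 𝔔` for the chosen `ι : K̄ ≅ L̄`) with `γ ∈ I_𝔔 ⟺ γ|_{K̄} ∈ I_𝔓`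
  (the tree's `exists_primesAbove_mem_inertia_iff` starts from `𝔓` instead; here the prime UPSTAIRS is prescribed, which is what a statement
  quantified over all places `w` of `L` needs);
* `conj_mem_inertia_smul` — `σ ∈ I_𝔓 ⟹ g σ g⁻¹ ∈ I_{g • 𝔓}`;
* `isUnramifiedIn_ringOfIntegers_of_not_dvd_discr` — Dedekind: `q ∤ d_K ⟹` the place of `ℚ` at `q` is unramified in `𝓞 K` (Mathlib
  `NumberField.not_dvd_discr_iff_forall_mem`, transported from `ℤ` to `𝓞 ℚ`);
* `exists_inertia_smul_ne_baseChange_of_isUnramifiedIn` — THE TRANSFER: `K ∕ ℚ` Galois, `v` unramified in `K`, some `σ ∈ I_𝔓₀` (`𝔓₀ ∣ v`)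
  moving a point of `E[n]` ⟹ at EVERY place `w ∣ v` of `K` and for SOME `𝔔 ∣ w`, some `τ ∈ I_𝔔 ≤ Γ_K` moves a point of `E_K[n]`
  (transitivity of `Γ_ℚ` on the primes above `v`, `I_𝔓 ≤ res(Γ_K)` — tree `inertia_le_range_absGaloisRestrict_of_isUnramifiedIn` —, and the
  `Γ_K`-equivariant `E[n] ≃ E_K[n]`, tree `RatClosure.torsionEquiv`);
* `forall_exists_inertia_smul_ne_baseChange_of_allRamified` — (RAM) EXACTLY as `…AdmdefHowardVanishing` consumes it, from the binders of the
  line: `[K : ℚ] = 2`, `(N, d_K) = 1`, `N = N_E`, and binder (ii) «`E[p]` ramified at every `q ∣ N`» (a bad place `w` of `E/K` lies over a bad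
  prime `q` of `E/ℚ` — good reduction base-changes, tree `hasGoodReductionAt_baseChange_of_hasGoodReductionAt_rat` — so `q ∣ N_E`, and `q ∤ d_K`).

HONEST FRAMING: theorems only (no definition, no named fact, no `sorry`); nothing about the crux, the anchors (K1) or BSD is asserted.  After this
file the rigidity-road result `…AdmdefHowardRigidityRoot.limitBaseClass_layer_zero_one_ne_zero_of_hasUnitLambda` is conditional, on the line's
all-ramified cell, only on the `±` control (CTRL) at `p` and the rank-one hypothesis.

References: [cite: NeukirchANT1999, Ch. I §9 Prop. (9.4), Ch. III §2 Cor. (2.12)] [cite: CastellaEtAl2025, Thm. 7.1 (ii) (arXiv:2308.10474v2 p. 29)]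
[cite: SilvermanAEC2009, VII.5 Prop. 5.1 (a)].
-/

-- D-0017: single-problem summit, the namespace repeats the problem name by design.
set_option linter.dupNamespace false
set_option autoImplicit false

noncomputable section

open scoped Classical NumberField Pointwise

namespace Summit.BirchSwinnertonDyer.BirchSwinnertonDyer.Theorems.SignedBaseChangeAcDivAdmdefRamifiedBaseChange

open WeierstrassCurve NumberField IsDedekindDomain Field
open Literature.NumberTheory.EllipticCurves Literature.NumberTheory.GaloisRepresentations

universe u

/-! ## §1 Inertia groups under `Γ_L → Γ_K` for a prescribed prime UPSTAIRS -/

section Inertia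

variable (K L : Type u) [Field K] [Field L] [Algebra K L]

/-- **Inertia under restriction, prime upstairs prescribed** (Neukirch I §9 (9.4): `I_𝔔(L) = I_𝔓 ∩ Γ_L`).  For an algebraic extension of number
fields `L ∕ K`, a place `w` of `L` over the place `v` of `K` and a prime `𝔔 ∣ w` of `\bar ℤ_L`, the prime `𝔓 = ι⁻¹(𝔔)` of `\bar ℤ_K` (for the
chosen `Γ_L`-equivariant isomorphism `ι : \bar ℤ_K ≅ \bar ℤ_L`, `absClosureEmbedding`) lies over `v`, and `γ ∈ Γ_L` is in `I_𝔔` iff `γ|_{K̄} ∈ I_𝔓`.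
[cite: NeukirchANT1999, Ch. I §9 Prop. (9.4)] -/
theorem exists_primesAbove_mem_inertia_iff_of_mem_primesAbove [Algebra.IsAlgebraic K L]
    {v : HeightOneSpectrum (𝓞 K)} {w : HeightOneSpectrum (𝓞 L)} (hw : w.asIdeal.under (𝓞 K) = v.asIdeal)
    {𝔔 : Ideal (absIntegers (𝓞 L) L)} (h𝔔 : 𝔔 ∈ w.primesAbove) :
    ∃ 𝔓 ∈ v.primesAbove, ∀ γ : absoluteGaloisGroup L,
      γ ∈ 𝔔.inertia (absoluteGaloisGroup L) ↔ absGaloisRestrict K L γ ∈ 𝔓.inertia (absoluteGaloisGroup K) := by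
  have hbij := Literature.NumberTheory.EllipticCurves.absClosureEmbedding_bijective K L
  -- the `Γ_L`-equivariant ring isomorphism `ιₒ : \bar ℤ_K → \bar ℤ_L` (as in the tree's `exists_primesAbove_mem_inertia_iff`)
  let ιo : absIntegers (𝓞 K) K →+* absIntegers (𝓞 L) L :=
    ((absClosureEmbedding K L).toRingHom.comp (absIntegers (𝓞 K) K).val.toRingHom).codRestrict
      (absIntegers (𝓞 L) L) (fun x ↦ absClosureEmbedding_mem_absIntegers K L x)
  have hιo : ∀ x : absIntegers (𝓞 K) K, ((ιo x : absIntegers (𝓞 L) L) : AlgebraicClosure L) = absClosureEmbedding K L x :=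
    fun _ ↦ rfl
  have hιo_surj : Function.Surjective ιo := fun y ↦ by
    obtain ⟨x, hx⟩ := hbij.2 (y : AlgebraicClosure L)
    exact ⟨⟨x, mem_absIntegers_of_absClosureEmbedding_mem K L (hx ▸ y.2)⟩, Subtype.ext hx⟩
  have hιo_smul : ∀ (γ : absoluteGaloisGroup L) (x : absIntegers (𝓞 K) K), ιo (absGaloisRestrict K L γ • x) = γ • ιo x :=
    fun γ x ↦ by
      apply Subtype.ext
      rw [hιo]
      change absClosureEmbedding K L (absGaloisRestrict K L γ • (x : AlgebraicClosure K)) = γ • absClosureEmbedding K L x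
      exact absGaloisRestrict_apply_smul K L γ x
  have hιo_alg : ιo.comp (algebraMap (𝓞 K) (absIntegers (𝓞 K) K)) =
      (algebraMap (𝓞 L) (absIntegers (𝓞 L) L)).comp (algebraMap (𝓞 K) (𝓞 L)) := by
    ext r
    change absClosureEmbedding K L (algebraMap (𝓞 K) (AlgebraicClosure K) r) =
      algebraMap (𝓞 L) (AlgebraicClosure L) (algebraMap (𝓞 K) (𝓞 L) r)
    rw [IsScalarTower.algebraMap_apply (𝓞 K) K (AlgebraicClosure K), AlgHom.commutes,
      IsScalarTower.algebraMap_apply (𝓞 L) L (AlgebraicClosure L),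
      ← IsScalarTower.algebraMap_apply (𝓞 K) (𝓞 L) L, IsScalarTower.algebraMap_apply (𝓞 K) K L,
      ← IsScalarTower.algebraMap_apply K L (AlgebraicClosure L)]
  -- the prime `𝔓 = ιₒ⁻¹(𝔔)`
  haveI : 𝔔.IsPrime := h𝔔.1
  refine ⟨𝔔.comap ιo, ⟨Ideal.comap_isPrime ιo 𝔔, ⟨?_⟩⟩, fun γ ↦ ⟨fun hγ x ↦ ?_, fun hγ y ↦ ?_⟩⟩
  · -- `𝔓 ∩ 𝓞 K = (𝔔 ∩ 𝓞 L) ∩ 𝓞 K = w ∩ 𝓞 K = v`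
    change v.asIdeal = Ideal.comap (algebraMap (𝓞 K) (absIntegers (𝓞 K) K)) (Ideal.comap ιo 𝔔)
    rw [Ideal.comap_comap, hιo_alg, ← Ideal.comap_comap]
    change v.asIdeal = (𝔔.under (𝓞 L)).under (𝓞 K)
    rw [← h𝔔.2.over, hw]
  · -- `γ ∈ I_𝔔 ⇒ res γ ∈ I_𝔓`
    refine Ideal.mem_comap.mpr ?_
    rw [map_sub, hιo_smul]
    exact hγ (ιo x)
  · -- `res γ ∈ I_𝔓 ⇒ γ ∈ I_𝔔`
    obtain ⟨x, rfl⟩ := hιo_surj y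
    rw [← hιo_smul, ← map_sub]
    exact Ideal.mem_comap.mp (hγ x)

end Inertia

/-! ## §2 Conjugating inertia; unramified primes -/

section Conj

variable {K : Type u} [Field K]

/-- `σ ∈ I_𝔓 ⟹ g σ g⁻¹ ∈ I_{g • 𝔓}` (inertia groups of conjugate primes are conjugate). [cite: NeukirchANT1999, Ch. I §9 (9.3)] -/
theorem conj_mem_inertia_smul [NumberField K] {𝔓 : Ideal (absIntegers (𝓞 K) K)} {σ : absoluteGaloisGroup K}
    (hσ : σ ∈ 𝔓.inertia (absoluteGaloisGroup K)) (g : absoluteGaloisGroup K) :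
    g * σ * g⁻¹ ∈ (g • 𝔓).inertia (absoluteGaloisGroup K) := by
  intro x
  have h1 : (g * σ * g⁻¹) • x - x = g • (σ • (g⁻¹ • x) - g⁻¹ • x) := by
    rw [smul_sub, mul_smul, mul_smul, smul_inv_smul]
  rw [h1]
  exact Ideal.smul_mem_pointwise_smul g _ 𝔓 (hσ (g⁻¹ • x))

/-- **Dedekind's discriminant theorem, the direction used here**: if the rational prime `q` under the place `v` of `ℚ` does not divide `d_K`,
then `v` is unramified in `𝓞 K` (Mathlib `NumberField.not_dvd_discr_iff_forall_mem` over `ℤ`, transported to `𝓞 ℚ` by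
`Algebra.IsUnramifiedAt.of_restrictScalars`). [cite: NeukirchANT1999, Ch. III §2 Cor. (2.12)] -/
theorem isUnramifiedIn_ringOfIntegers_of_not_dvd_discr (K : Type u) [Field K] [NumberField K] (v : HeightOneSpectrum (𝓞 ℚ))
    {q : ℕ} (hq : q.Prime) (hqv : ((q : ℕ) : 𝓞 ℚ) ∈ v.asIdeal) (hnd : ¬ (q : ℤ) ∣ NumberField.discr K) :
    Algebra.IsUnramifiedIn (𝓞 K) v.asIdeal := by
  intro P _ hP
  have hp : Prime (q : ℤ) := Nat.prime_iff_prime_int.mp hq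
  have h2 : algebraMap (𝓞 ℚ) (𝓞 K) ((q : ℕ) : 𝓞 ℚ) ∈ P := by
    rw [hP.over] at hqv
    exact Ideal.mem_comap.mp hqv
  rw [map_natCast] at h2
  have hunr := (NumberField.not_dvd_discr_iff_forall_mem K (𝓞 K) hp).mp hnd P ‹_› (by exact_mod_cast h2)
  exact Algebra.IsUnramifiedAt.of_restrictScalars (R := ℤ) (A := 𝓞 ℚ) P

end Conj

/-! ## §3 The transfer `ℚ → K` -/

section Transfer

variable (W : WeierstrassCurve ℚ) {K : Type} [Field K] [NumberField K]

/-- **Ramification of `E[n]` transfers from `ℚ` to a Galois `K` at a prime unramified in `K`.**  Let `K ∕ ℚ` be Galois, `v` a place of `ℚ`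
unramified in `𝓞 K`, and suppose some `σ` in the inertia group `I_{𝔓₀} ≤ Γ_ℚ` of some prime `𝔓₀ ∣ v` of `\bar ℤ` moves a point of
`E[n] = E(ℚ̄)[n]`.  Then at EVERY place `w ∣ v` of `K` there are a prime `𝔔 ∣ w` of `\bar ℤ_K` and `τ ∈ I_𝔔 ≤ Γ_K` moving a point of `E_K[n] =
E(K̄)[n]`.  (Pick `𝔔 ∣ w`; `𝔓 = ι⁻¹ 𝔔 ∣ v` with `I_𝔔 = res⁻¹ I_𝔓` (§1); `𝔓 = g • 𝔓₀`, so `g σ g⁻¹ ∈ I_𝔓` moves `g • P`; `I_𝔓 ≤ res Γ_K` as `v` is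
unramified in the Galois `K` (tree `inertia_le_range_absGaloisRestrict_of_isUnramifiedIn`); transport along the `Γ_K`-equivariant
`E[n] ≃ E_K[n]` (tree `RatClosure.torsionEquiv`).) [cite: NeukirchANT1999, Ch. I §9 Prop. (9.4)] -/
theorem exists_inertia_smul_ne_baseChange_of_isUnramifiedIn [IsGalois ℚ K] {v : HeightOneSpectrum (𝓞 ℚ)}
    (hunr : Algebra.IsUnramifiedIn (𝓞 K) v.asIdeal) {n : ℤ}
    (hram : ∃ 𝔓₀ ∈ v.primesAbove, ∃ σ ∈ 𝔓₀.inertia (absoluteGaloisGroup ℚ), ∃ P : W.geomTorsion n, σ • P ≠ P)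
    (w : HeightOneSpectrum (𝓞 K)) (hw : w.asIdeal.under (𝓞 ℚ) = v.asIdeal) :
    ∃ 𝔔 ∈ w.primesAbove, ∃ τ ∈ 𝔔.inertia (absoluteGaloisGroup K), ∃ P : geomTorsion (W.baseChange K) n, τ • P ≠ P := by
  -- a prime `𝔔 ∣ w` of `\bar ℤ_K`
  obtain ⟨𝔐, h𝔐⟩ := w.localPrimesAbove_nonempty
  have h𝔔 := HeightOneSpectrum.primeBelow_mem_primesAbove (ι := closureEmb (K := K) (w.adicCompletion K)) h𝔐
  obtain ⟨𝔓, h𝔓, hiff⟩ := exists_primesAbove_mem_inertia_iff_of_mem_primesAbove ℚ K hw h𝔔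
  obtain ⟨𝔓₀, h𝔓₀, σ, hσ, P, hP⟩ := hram
  -- `𝔓 = g • 𝔓₀`
  obtain ⟨g, hg⟩ := HeightOneSpectrum.exists_smul_eq_of_mem_primesAbove_holds h𝔓₀ h𝔓
  have hσ' : g * σ * g⁻¹ ∈ 𝔓.inertia (absoluteGaloisGroup ℚ) := hg ▸ conj_mem_inertia_smul hσ g
  have hP' : (g * σ * g⁻¹) • (g • P) ≠ g • P := by
    rw [mul_smul, mul_smul, inv_smul_smul]
    exact fun h ↦ hP (MulAction.injective g h)
  -- `g σ g⁻¹ = res τ` with `τ ∈ Γ_K`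
  obtain ⟨τ, hτ⟩ := inertia_le_range_absGaloisRestrict_of_isUnramifiedIn (K := K) hunr h𝔓 hσ'
  have hτ' : absGaloisRestrict ℚ K τ = g * σ * g⁻¹ := hτ
  refine ⟨_, h𝔔, τ, (hiff τ).mpr (by rw [hτ']; exact hσ'), RatClosure.torsionEquiv (K := K) W n (g • P), fun h ↦ hP' ?_⟩
  rw [← hτ']
  apply (RatClosure.torsionEquiv (K := K) W n).injective
  rw [RatClosure.torsionEquiv_smul]
  exact h

/-- **(RAM) for `E/K` from the line's `ℚ`-side binder «`E[p]` ramified at every `q ∣ N`»** — exactly the hypothesis `hram` of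
`…AdmdefHowardVanishing.eq_zero_of_mem_signedOrdSelmerTorsion_of_isUnit_lam` ∕ `…AdmdefHowardRigidityRoot`.  For `E/ℚ` elliptic with `N = N_E`,
`K` quadratic with `(N, d_K) = 1`, and binder (ii) of C⁺⁺ (`∀ q ∣ N` prime, some inertia element at a prime of `\bar ℤ` over `q` moves a point
of `E[p]`): at every bad place `w` of `E/K` some `τ` in the inertia group of some prime `𝔔 ∣ w` of `\bar ℤ_K` moves a point of `E_K[p]`.  (A bad
`w` lies over a bad `q` — good reduction base-changes, tree `hasGoodReductionAt_baseChange_of_hasGoodReductionAt_rat` — so `q ∣ N_E`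
(`natGenerator_dvd_conductorNorm_iff`) and `q ∤ d_K`; then `exists_inertia_smul_ne_baseChange_of_isUnramifiedIn`.)  The hypothesis `w ∤ p` of
(RAM) is not needed. [cite: CastellaEtAl2025, Thm. 7.1 (ii) (arXiv:2308.10474v2 p. 29)] [cite: NeukirchANT1999, Ch. I §9 Prop. (9.4)] -/
theorem forall_exists_inertia_smul_ne_baseChange_of_allRamified [W.IsElliptic] (hK2 : Module.finrank ℚ K = 2) {p : ℕ}
    {N : ℕ} (hN : (N : ℤ) = W.conductorNorm ℤ) (hND : IsCoprime (N : ℤ) (NumberField.discr K))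
    (hall : ∀ q : ℕ, q.Prime → q ∣ N → ∃ v' : HeightOneSpectrum (𝓞 ℚ), ((q : ℕ) : 𝓞 ℚ) ∈ v'.asIdeal ∧
      ∃ 𝔓 ∈ v'.primesAbove, ∃ σ ∈ 𝔓.inertia (absoluteGaloisGroup ℚ), ∃ P : W.geomTorsion (p : ℤ), σ • P ≠ P) :
    ∀ w : HeightOneSpectrum (𝓞 K), ¬ (W.baseChange K).HasGoodReductionAt w → ((p : ℕ) : 𝓞 K) ∉ w.asIdeal →
      ∃ 𝔔 ∈ w.primesAbove, ∃ τ ∈ 𝔔.inertia (absoluteGaloisGroup K),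
        ∃ P : geomTorsion (W.baseChange K) ((p ^ 1 : ℕ) : ℤ), τ • P ≠ P := by
  intro w hbad _
  haveI : IsGalois ℚ K := by
    haveI : Algebra.IsQuadraticExtension ℚ K := ⟨hK2⟩
    infer_instance
  -- the place `v` of `ℚ` under `w` and its rational prime `q`
  have hne : w.asIdeal.under (𝓞 ℚ) ≠ ⊥ := Ideal.under_ne_bot (A := 𝓞 ℚ) w.ne_bot
  let v : HeightOneSpectrum (𝓞 ℚ) := ⟨w.asIdeal.under (𝓞 ℚ), Ideal.comap_isPrime _ _, hne⟩
  have hw : w.asIdeal.under (𝓞 ℚ) = v.asIdeal := rfl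
  haveI : w.asIdeal.LiesOver v.asIdeal := ⟨hw.symm⟩
  set q : Nat.Primes := Rat.HeightOneSpectrum.primesEquiv v with hqdef
  haveI : Fact (q : ℕ).Prime := ⟨q.2⟩
  have hqv : ((q : ℕ) : 𝓞 ℚ) ∈ v.asIdeal := (Rat.natCast_mem_asIdeal_iff (v := v)).mpr dvd_rfl
  -- `E/ℚ` is bad at `v`, so `q ∣ N`
  have hbadQ : ¬ W.HasGoodReductionAt v := fun hg ↦ hbad (hasGoodReductionAt_baseChange_of_hasGoodReductionAt_rat W v w hg)
  have hqN : (q : ℕ) ∣ N := by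
    have h1 : ¬ W.HasGoodReductionAtPrime (q : ℕ) := fun hg ↦
      hbadQ ((hasGoodReductionAtPrime_iff_hasGoodReductionAt_ringOfIntegers v W).mp hg)
    have h2 : ¬ W.HasGoodReductionAt ((Rat.HeightOneSpectrum.primesEquiv (R := ℤ)).symm q) := fun hg ↦
      h1 ((W.hasGoodReductionAtPrime_iff_hasGoodReductionAt_holds q).mpr hg)
    have h3 := (natGenerator_dvd_conductorNorm_iff ((Rat.HeightOneSpectrum.primesEquiv (R := ℤ)).symm q) W).mpr h2
    have hgen : Rat.HeightOneSpectrum.natGenerator ((Rat.HeightOneSpectrum.primesEquiv (R := ℤ)).symm q) = q :=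
      congrArg Subtype.val ((Rat.HeightOneSpectrum.primesEquiv (R := ℤ)).apply_symm_apply q)
    rw [hgen] at h3
    have hN' : (W.conductorNorm ℤ : ℕ) = N := by exact_mod_cast hN.symm
    rwa [hN'] at h3
  -- `q ∤ d_K`, so `v` is unramified in `K`
  have hnd : ¬ ((q : ℕ) : ℤ) ∣ NumberField.discr K := by
    intro hd
    have hu := hND.isUnit_of_dvd' (Int.natCast_dvd_natCast.mpr hqN) hd
    rw [Int.isUnit_iff_natAbs_eq, Int.natAbs_natCast] at hu
    exact q.2.one_lt.ne' hu
  have hunr := isUnramifiedIn_ringOfIntegers_of_not_dvd_discr K v q.2 hqv hnd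
  -- the `ℚ`-side witness at `q`, at the place `v' = v`
  obtain ⟨v', hqv', hram⟩ := hall q q.2 hqN
  have hvv' : v' = v := HeightOneSpectrum.eq_of_natCast_mem_rat q.2 hqv' hqv
  rw [hvv'] at hram
  rw [pow_one]
  exact exists_inertia_smul_ne_baseChange_of_isUnramifiedIn W hunr hram w hw

end Transfer

end Summit.BirchSwinnertonDyer.BirchSwinnertonDyer.Theorems.SignedBaseChangeAcDivAdmdefRamifiedBaseChange

end
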